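import Mathlib.LinearAlgebra.Eigenspace.Pi
import Mathlib.LinearAlgebra.Eigenspace.Semisimple
import Mathlib.LinearAlgebra.Eigenspace.Triangularizable
import Mathlib.LinearAlgebra.Finsupp.LinearCombination
import Literature.NumberTheory.Automorphic.LinearAlgebraicGroups
import HarnessLib

/-!
# Commutative groups of semisimple matrices: characters span the coordinate ring
(trunk T-AUTOMORPHIC, G25 AutomorphicL; Springer, *Linear Algebraic Groups*, 2.4.2 (ii), 3.2.3)

Companion to `LinearAlgebraicGroups.lean` (namespace `Literature.Automorphic`, same concrete vocabulary:
subgroups `T ≤ GL m k`, coordinates `x i j, det⁻¹` (`glCoordFun`), algebraic characters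
`IsAlgebraicChar`, the character group `characterLattice T = X*(T)`). For a *commutative*
subgroup `T ≤ GL m k` *consisting of semisimple elements* over an algebraically closed field —
in particular for a torus `IsTorusSubgroup T` — we prove, sorry-free:

* `iSup_weightSpace_eq_top` (Springer 2.4.2 (ii): a set of pairwise commuting semisimple
  matrices is simultaneously diagonalisable): `k^m = ⨆_w V_w`, where for a function
  `w : T → k` the *weight space* `V_w = weightSpace T w` is `{v | t v = w(t) v ∀ t ∈ T}`;
  from Mathlib's simultaneous triangularisation of commuting families
  (`Module.End.iSup_iInf_maxGenEigenspace_eq_top_of_iSup_maxGenEigenspace_eq_top_of_commute`)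
  and `maxGenEigenspace = eigenspace` for semisimple endomorphisms.
* `weightChar`, `isAlgebraicChar_weightChar`: the weight `w` of a non-zero weight vector is an
  algebraic character of `T` (Springer 3.2.3, proof of (c) ⇒ (a) via 2.3.7 (i)).
* `eval_mem_charSpan` (Springer 3.2.3 (b), second clause, for the diagonalisable group `T`:
  *the characters span `k[T]`*): the restriction to `T` of every polynomial in the coordinates
  `x i j, det⁻¹` is a `k`-linear combination of algebraic characters of `T`
  (`charSpan T = span_k X*(T) ⊆ (T → k)`); in particular every matrix entry is
  (`entry_mem_charSpan`), and `det⁻¹` is itself a character (`detInvChar`).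
* `isAlgebraicGL_of_isAlgebraicChar_comp` (Springer 3.2.3 with 3.2.6: a homomorphism into a
  diagonalisable group is a morphism of algebraic groups as soon as it pulls characters back to
  characters, because the characters span the coordinate ring): if `φ : T₀ → T` is a group
  homomorphism from a subgroup `T₀ ≤ GL n k` such that `χ ∘ φ` is an algebraic character of `T₀`
  for every algebraic character `χ` of `T`, then `φ` has polynomial coordinates
  (`MonoidHom.IsAlgebraicGL`). This is the step "`φ|_T : T → T₁` is a morphism" in the proof of
  the isomorphism theorem 9.6.2 (used by `ReductiveDualProofs`).

## Mathlib

Eigenspaces, semisimple endomorphisms and simultaneous triangularisation are Mathlib's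
(`Module.End.eigenspace`, `Module.End.IsSemisimple`, `Module.End.iSup_maxGenEigenspace_eq_top`,
`Module.End.IsFinitelySemisimple.maxGenEigenspace_eq_eigenspace`, the `Eigenspace.Pi` file).
Mathlib has no diagonalisable *groups*, characters of matrix groups or `k[G]`; nothing here
duplicates a Mathlib declaration (searched `weightSpace` — only for Lie algebras,
`LieModule.weightSpace`, a different notion —, `Diagonalizable`, `characterLattice`).

## References

* T. A. Springer, *Linear Algebraic Groups*, 2nd ed. (1998), Lemma 2.4.2 (ii), Theorem 3.2.3,
  3.2.6–3.2.7, and the proof of 9.6.2 [SpringerLAG1998].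
-/

open scoped IsMulCommutative MatrixGroups

namespace Literature.NumberTheory.Automorphic

variable {k : Type*} [Field k] {m : Type*} [Fintype m] [DecidableEq m] {T : Subgroup (GL m k)}

/-! ### The span of the characters inside the functions on `T` -/

variable (T) in
/-- The `k`-span `charSpan T ⊆ (T → k)` of the (underlying functions of the) algebraic characters
`χ ∈ X*(T)`; for a diagonalisable `T` this is the whole coordinate ring `k[T]`
(`eval_mem_charSpan`; Springer 3.2.3 (b)). [cite: SpringerLAG1998, 3.2.3] -/
noncomputable def charSpan : Submodule k (↥T → k) :=
  Submodule.span k (Set.range fun χ : ↥(characterLattice T) => fun t => (((χ : ↥T →* kˣ) t : kˣ) : k))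

/-- The function underlying an algebraic character lies in `charSpan T`. [folklore] -/
lemma coeFn_mem_charSpan (χ : ↥(characterLattice T)) :
    (fun t => (((χ : ↥T →* kˣ) t : kˣ) : k)) ∈ charSpan T :=
  Submodule.subset_span ⟨χ, rfl⟩

/-- The function underlying an algebraic character lies in `charSpan T` (unbundled form).
[folklore] -/
lemma coeFn_mem_charSpan' {χ : ↥T →* kˣ} (hχ : IsAlgebraicChar χ) :
    (fun t => ((χ t : kˣ) : k)) ∈ charSpan T :=
  coeFn_mem_charSpan ⟨χ, hχ⟩

/-- The constant function `1` (the trivial character) lies in `charSpan T`. [folklore] -/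
lemma one_mem_charSpan : (1 : ↥T → k) ∈ charSpan T := by
  have e : (1 : ↥T → k) = fun t => ((((1 : ↥(characterLattice T)) : ↥T →* kˣ) t : kˣ) : k) := by
    funext t
    simp
  rw [e]
  exact coeFn_mem_charSpan 1

/-- Constant functions lie in `charSpan T`. [folklore] -/
lemma const_mem_charSpan (a : k) : (fun _ : ↥T => a) ∈ charSpan T := by
  have h : (fun _ : ↥T => a) = a • (1 : ↥T → k) := by funext t; simp
  rw [h]
  exact Submodule.smul_mem _ a one_mem_charSpan

/-- `charSpan T` is closed under pointwise multiplication (a product of characters is a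
character). [folklore] -/
lemma mul_mem_charSpan {f g : ↥T → k} (hf : f ∈ charSpan T) (hg : g ∈ charSpan T) :
    f * g ∈ charSpan T := by
  induction hf using Submodule.span_induction generalizing g with
  | mem x hx =>
    obtain ⟨χ, rfl⟩ := hx
    induction hg using Submodule.span_induction with
    | mem y hy =>
      obtain ⟨ψ, rfl⟩ := hy
      have e : ((fun t => (((χ : ↥T →* kˣ) t : kˣ) : k)) * fun t => (((ψ : ↥T →* kˣ) t : kˣ) : k)) =
          fun t => ((((χ * ψ : ↥(characterLattice T)) : ↥T →* kˣ) t : kˣ) : k) := by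
        funext t
        simp
      rw [e]
      exact coeFn_mem_charSpan (χ * ψ)
    | zero => simp
    | add y z _ _ hy hz => simpa [mul_add] using Submodule.add_mem _ hy hz
    | smul a y _ hy => simpa [mul_smul_comm] using Submodule.smul_mem _ a hy
  | zero => simp
  | add x y _ _ hx hy => simpa [add_mul] using Submodule.add_mem _ (hx hg) (hy hg)
  | smul a x _ hx => simpa [smul_mul_assoc] using Submodule.smul_mem _ a (hx hg)

/-- `charSpan T` is closed under finite products. [folklore] -/
lemma prod_mem_charSpan {ι : Type*} (s : Finset ι) (f : ι → ↥T → k)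
    (hf : ∀ i ∈ s, f i ∈ charSpan T) : (∏ i ∈ s, f i) ∈ charSpan T := by
  classical
  induction s using Finset.induction_on with
  | empty => simpa using one_mem_charSpan
  | insert a s ha ih =>
    rw [Finset.prod_insert ha]
    exact mul_mem_charSpan (hf a (Finset.mem_insert_self a s))
      (ih fun i hi => hf i (Finset.mem_insert_of_mem hi))

/-! ### The determinant character -/

variable (T) in
/-- The determinant, as a character `T → 𝔾ₘ` of a subgroup `T ≤ GL m k`. [folklore] -/
noncomputable def detCharGL : ↥T →* kˣ :=
  (Matrix.GeneralLinearGroup.det).comp T.subtype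

/-- The value of the determinant character. [folklore] -/
@[simp] lemma detCharGL_apply (t : ↥T) :
    ((detCharGL T t : kˣ) : k) = Matrix.det ((t : GL m k) : Matrix m m k) := rfl

/-- The determinant character is algebraic (it is the polynomial `det (x i j)`). [folklore] -/
lemma isAlgebraicChar_detCharGL : IsAlgebraicChar (detCharGL T) := by
  refine ⟨(genericMatrixGL m k).det, fun t => ?_⟩
  rw [detCharGL_apply, RingHom.map_det, eval_mapMatrix_genericMatrixGL]

/-- The coordinate `det⁻¹` restricted to `T` is the character `(detCharGL T)⁻¹`, hence lies in
`charSpan T`. [folklore] -/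
lemma detInv_mem_charSpan :
    (fun t : ↥T => (Matrix.det ((t : GL m k) : Matrix m m k))⁻¹) ∈ charSpan T := by
  have h := coeFn_mem_charSpan' (T := T) (isAlgebraicChar_detCharGL.inv)
  convert h using 2 with t
  simp [detCharGL]

/-! ### Weight spaces of a commutative group of semisimple matrices -/

variable (T) in
/-- The *weight space* of a function `w : T → k`: the simultaneous eigenspace
`V_w = {v ∈ k^m | t • v = w(t) v for all t ∈ T}` (Springer 2.4.2, 3.2.3). [folklore] -/
noncomputable def weightSpace (w : ↥T → k) : Submodule k (m → k) :=
  ⨅ t : ↥T, Module.End.eigenspace (Matrix.toLin' ((t : GL m k) : Matrix m m k)) (w t)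

/-- Membership in a weight space: `t v = w(t) v` for all `t ∈ T`. [folklore] -/
lemma mem_weightSpace_iff {w : ↥T → k} {v : m → k} :
    v ∈ weightSpace T w ↔ ∀ t : ↥T, Matrix.mulVec ((t : GL m k) : Matrix m m k) v = w t • v := by
  simp [weightSpace, Submodule.mem_iInf, Matrix.toLin'_apply]

/-- **Simultaneous diagonalisation** (Springer, *Linear Algebraic Groups*, 2.4.2 (ii)): over an
algebraically closed field, if `T ≤ GL m k` is commutative and consists of semisimple elements
then `k^m` is the sum of the weight spaces `V_w` (`w : T → k`); equivalently some conjugate of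
`T` is diagonal. Mathlib's simultaneous triangularisation of commuting families plus
`maxGenEigenspace = eigenspace` for semisimple endomorphisms. [cite: SpringerLAG1998, 2.4.2 (ii)] -/
theorem iSup_weightSpace_eq_top [IsAlgClosed k] [IsMulCommutative ↥T]
    (hs : ∀ t ∈ T, IsSemisimpleElt t) : ⨆ w : ↥T → k, weightSpace T w = ⊤ := by
  set f : ↥T → Module.End k (m → k) := fun t => Matrix.toLin' ((t : GL m k) : Matrix m m k)
    with hf_def
  have hcomm : Pairwise fun s t : ↥T => Commute (f s) (f t) := by
    intro s t _
    have hst : ((s : GL m k) : Matrix m m k) * ((t : GL m k) : Matrix m m k) =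
        ((t : GL m k) : Matrix m m k) * ((s : GL m k) : Matrix m m k) := by
      have h := congrArg (fun x : ↥T => ((x : GL m k) : Matrix m m k)) (mul_comm s t)
      simpa using h
    change f s * f t = f t * f s
    rw [hf_def, Module.End.mul_eq_comp, Module.End.mul_eq_comp, ← Matrix.toLin'_mul,
      ← Matrix.toLin'_mul, hst]
  have h' : ∀ t : ↥T, ⨆ μ : k, (f t).maxGenEigenspace μ = ⊤ := fun t =>
    Module.End.iSup_maxGenEigenspace_eq_top (f t)
  have key :=
    Module.End.iSup_iInf_maxGenEigenspace_eq_top_of_iSup_maxGenEigenspace_eq_top_of_commute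
      f hcomm h'
  have hss : ∀ t : ↥T, (f t).IsFinitelySemisimple := fun t =>
    (hs (t : GL m k) t.2).isFinitelySemisimple
  have e : ∀ w : ↥T → k, (⨅ t : ↥T, (f t).maxGenEigenspace (w t)) = weightSpace T w :=
    fun w => iInf_congr fun t => (hss t).maxGenEigenspace_eq_eigenspace (w t)
  simpa only [e] using key

/-! ### The weight of a non-zero weight vector is an algebraic character -/

section Weight

variable {w : ↥T → k} {v : m → k}

/-- The weight of a non-zero weight vector is multiplicative. [folklore] -/
lemma weight_mul (hv : v ∈ weightSpace T w) (hv0 : v ≠ 0) (s t : ↥T) :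
    w (s * t) = w s * w t := by
  rw [mem_weightSpace_iff] at hv
  have h1 := hv (s * t)
  have h2 : Matrix.mulVec (((s * t : ↥T) : GL m k) : Matrix m m k) v = (w s * w t) • v := by
    have e : (((s * t : ↥T) : GL m k) : Matrix m m k) =
        ((s : GL m k) : Matrix m m k) * ((t : GL m k) : Matrix m m k) := by simp
    rw [e, ← Matrix.mulVec_mulVec, hv t, Matrix.mulVec_smul, hv s, smul_smul, mul_comm]
  rw [h1] at h2
  exact smul_left_injective k hv0 h2

/-- The weight of a non-zero weight vector takes the value `1` at `1`. [folklore] -/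
lemma weight_one (hv : v ∈ weightSpace T w) (hv0 : v ≠ 0) : w 1 = 1 := by
  rw [mem_weightSpace_iff] at hv
  have h1 := hv 1
  simp only [OneMemClass.coe_one, Units.val_one, Matrix.one_mulVec] at h1
  have h2 : (1 : k) • v = w 1 • v := by simpa using h1
  exact (smul_left_injective k hv0 h2).symm

/-- The weight of a non-zero weight vector does not vanish (its arguments are invertible).
[folklore] -/
lemma weight_ne_zero (hv : v ∈ weightSpace T w) (hv0 : v ≠ 0) (t : ↥T) : w t ≠ 0 := by
  intro h
  have h1 := weight_mul hv hv0 t t⁻¹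
  rw [mul_inv_cancel, weight_one hv hv0, h, zero_mul] at h1
  exact one_ne_zero h1

/-- The weight `w : T → k` of a non-zero weight vector `v ∈ V_w`, as a character `T → 𝔾ₘ`
(Springer 3.2.3, proof). [folklore] -/
noncomputable def weightChar (hv : v ∈ weightSpace T w) (hv0 : v ≠ 0) : ↥T →* kˣ where
  toFun t := Units.mk0 (w t) (weight_ne_zero hv hv0 t)
  map_one' := Units.ext (by simp [weight_one hv hv0])
  map_mul' s t := Units.ext (by simp [weight_mul hv hv0])

/-- The character `weightChar` has underlying function the weight `w`. [folklore] -/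
@[simp] lemma weightChar_apply (hv : v ∈ weightSpace T w) (hv0 : v ≠ 0) (t : ↥T) :
    ((weightChar hv hv0 t : kˣ) : k) = w t := rfl

/-- The weight of a non-zero weight vector is an *algebraic* character: if `v l ≠ 0` then
`w(t) = (v l)⁻¹ ∑ j, t l j · v j` is linear in the entries of `t` (Springer 3.2.3, proof of
(c) ⇒ (a) via 2.3.7 (i)). [cite: SpringerLAG1998, 3.2.3] -/
theorem isAlgebraicChar_weightChar (hv : v ∈ weightSpace T w) (hv0 : v ≠ 0) :
    IsAlgebraicChar (weightChar hv hv0) := by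
  obtain ⟨l, hl⟩ : ∃ l, v l ≠ 0 := Function.ne_iff.mp hv0
  refine ⟨MvPolynomial.C (v l)⁻¹ * ∑ j : m, MvPolynomial.C (v j) * MvPolynomial.X (Sum.inl (l, j)),
    fun t => ?_⟩
  have h := congrFun ((mem_weightSpace_iff.mp hv) t) l
  simp only [Matrix.mulVec, dotProduct, Pi.smul_apply, smul_eq_mul] at h
  -- `h : ∑ j, t l j * v j = w t * v l`
  have h2 : ∑ j, v j * ((t : GL m k) : Matrix m m k) l j = w t * v l :=
    (Finset.sum_congr rfl fun j _ => mul_comm _ _).trans h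
  simp only [weightChar_apply, map_mul, MvPolynomial.eval_C, map_sum, MvPolynomial.eval_X,
    glCoordFun_inl]
  calc w t = (v l)⁻¹ * (w t * v l) := by field_simp
    _ = _ := congrArg (fun y => (v l)⁻¹ * y) h2.symm

/-- Hence the weight function of a non-zero weight vector lies in `charSpan T`. [folklore] -/
lemma weight_mem_charSpan (hv : v ∈ weightSpace T w) (hv0 : v ≠ 0) : w ∈ charSpan T := by
  have h := coeFn_mem_charSpan' (isAlgebraicChar_weightChar hv hv0)
  simpa only [weightChar_apply] using h

end Weight

/-! ### The characters span the coordinate ring (Springer 3.2.3 (b)) -/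

/-- Every matrix entry, restricted to a commutative group `T ≤ GL m k` of semisimple matrices
over an algebraically closed field, is a `k`-linear combination of algebraic characters of `T`:
decompose the basis vector `e_j = ∑_w v_w` into weight vectors (`iSup_weightSpace_eq_top`), then
`t i j = (t e_j) i = ∑_w w(t) (v_w) i` (Springer 3.2.3 (b) for the coordinate functions).
[cite: SpringerLAG1998, 3.2.3 (b) with 2.4.2 (ii)] -/
theorem entry_mem_charSpan [IsAlgClosed k] [IsMulCommutative ↥T]
    (hs : ∀ t ∈ T, IsSemisimpleElt t) (i j : m) :
    (fun t : ↥T => ((t : GL m k) : Matrix m m k) i j) ∈ charSpan T := by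
  have hj : (Pi.single j 1 : m → k) ∈ ⨆ w : ↥T → k, weightSpace T w := by
    rw [iSup_weightSpace_eq_top hs]; trivial
  obtain ⟨c, hc, hsum⟩ := (Submodule.mem_iSup_iff_exists_finsupp _ _).mp hj
  have key : (fun t : ↥T => ((t : GL m k) : Matrix m m k) i j) =
      ∑ w ∈ c.support, fun t => (c w) i * w t := by
    funext t
    have e1 : ((t : GL m k) : Matrix m m k) i j =
        (Matrix.mulVec ((t : GL m k) : Matrix m m k) (Pi.single j 1)) i := by
      rw [Matrix.mulVec_single_one]; rfl
    rw [e1, ← hsum, Finsupp.sum, Matrix.mulVec_sum, Finset.sum_apply, Finset.sum_apply]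
    refine Finset.sum_congr rfl fun w _ => ?_
    rw [(mem_weightSpace_iff.mp (hc w)) t, Pi.smul_apply, smul_eq_mul, mul_comm]
  rw [key]
  refine Submodule.sum_mem _ fun w hw => ?_
  have hw0 : c w ≠ 0 := Finsupp.mem_support_iff.mp hw
  have e2 : (fun t => (c w) i * w t) = (c w) i • w := by funext t; simp
  rw [e2]
  exact Submodule.smul_mem _ _ (weight_mem_charSpan (hc w) hw0)

/-- **The characters span the coordinate ring** (Springer, *Linear Algebraic Groups*, 3.2.3 (b),
for the diagonalisable group `T`: "its elements [of `X*(T)`] form a `k`-basis of `k[T]`" — here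
the spanning half): over an algebraically closed field, for a commutative subgroup `T ≤ GL m k`
of semisimple matrices, the restriction to `T` of every polynomial in the coordinates
`x i j, det⁻¹` is a `k`-linear combination of algebraic characters of `T`.
[cite: SpringerLAG1998, 3.2.3 (b)] -/
theorem eval_mem_charSpan [IsAlgClosed k] [IsMulCommutative ↥T]
    (hs : ∀ t ∈ T, IsSemisimpleElt t) (p : MvPolynomial (GLCoord m) k) :
    (fun t : ↥T => MvPolynomial.eval (glCoordFun (t : GL m k)) p) ∈ charSpan T := by
  induction p using MvPolynomial.induction_on with
  | C a => simpa using const_mem_charSpan (T := T) a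
  | add p q hp hq =>
    have e : (fun t : ↥T => MvPolynomial.eval (glCoordFun (t : GL m k)) (p + q)) =
        (fun t : ↥T => MvPolynomial.eval (glCoordFun (t : GL m k)) p) +
          fun t : ↥T => MvPolynomial.eval (glCoordFun (t : GL m k)) q := by
      funext t
      simp only [map_add, Pi.add_apply]
    rw [e]
    exact Submodule.add_mem _ hp hq
  | mul_X p c hp =>
    have hX : (fun t : ↥T => MvPolynomial.eval (glCoordFun (t : GL m k)) (MvPolynomial.X c)) ∈
        charSpan T := by
      rcases c with ⟨i, j⟩ | u
      · simp only [MvPolynomial.eval_X, glCoordFun_inl]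
        exact entry_mem_charSpan hs i j
      · simp only [MvPolynomial.eval_X, glCoordFun_inr]
        exact detInv_mem_charSpan
    have e : (fun t : ↥T => MvPolynomial.eval (glCoordFun (t : GL m k)) (p * MvPolynomial.X c)) =
        (fun t : ↥T => MvPolynomial.eval (glCoordFun (t : GL m k)) p) *
          fun t : ↥T => MvPolynomial.eval (glCoordFun (t : GL m k)) (MvPolynomial.X c) := by
      funext t
      simp only [map_mul, Pi.mul_apply]
    rw [e]
    exact mul_mem_charSpan hp hX

/-- Unfolding membership in `charSpan T`: a finite linear combination of characters. [folklore] -/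
lemma exists_finsupp_of_mem_charSpan {f : ↥T → k} (hf : f ∈ charSpan T) :
    ∃ c : ↥(characterLattice T) →₀ k,
      ∀ t : ↥T, f t = c.sum fun χ a => a * (((χ : ↥T →* kˣ) t : kˣ) : k) := by
  obtain ⟨c, hc⟩ := Finsupp.mem_span_range_iff_exists_finsupp.mp hf
  refine ⟨c, fun t => ?_⟩
  rw [← hc]
  simp [Finsupp.sum, Finset.sum_apply]

/-! ### Homomorphisms into a diagonalisable group pulling back characters are algebraic -/

variable {n : Type*} [Fintype n] [DecidableEq n] {T₀ : Subgroup (GL n k)}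

/-- **A homomorphism into a diagonalisable group that pulls characters back to characters is a
morphism** (Springer, *Linear Algebraic Groups*, 3.2.3 (b) with 1.4.7: `φ` is a morphism iff
`φ*` maps `k[T]` into `k[T₀]`, and `k[T]` is spanned by `X*(T)`). Over an algebraically closed
field let `T ≤ GL m k` be commutative and consist of semisimple elements (e.g. a torus), let
`T₀ ≤ GL n k` be any subgroup and `φ : T₀ → T` a group homomorphism such that `χ ∘ φ` is an
algebraic character of `T₀` for every algebraic character `χ` of `T`. Then the coordinates of
`φ t₀` are polynomials in the coordinates of `t₀` (`MonoidHom.IsAlgebraicGL`). This is the step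
"`φ : T → T₁` is a homomorphism of tori" of the proof of the isomorphism theorem 9.6.2.
[cite: SpringerLAG1998, 3.2.3 (b) and 9.6.2 (proof)] -/
theorem isAlgebraicGL_of_isAlgebraicChar_comp [IsAlgClosed k] [IsMulCommutative ↥T]
    (hs : ∀ t ∈ T, IsSemisimpleElt t) (φ : ↥T₀ →* ↥T)
    (hφ : ∀ χ : ↥T →* kˣ, IsAlgebraicChar χ → IsAlgebraicChar (χ.comp φ)) :
    MonoidHom.IsAlgebraicGL (T.subtype.comp φ) := by
  classical
  -- each coordinate of `t ∈ T` is a finite combination of characters; choose one such expression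
  have H : ∀ c : GLCoord m, ∃ P : MvPolynomial (GLCoord n) k, ∀ t₀ : ↥T₀,
      glCoordFun ((φ t₀ : ↥T) : GL m k) c = MvPolynomial.eval (glCoordFun (t₀ : GL n k)) P := by
    intro c
    obtain ⟨cf, hcf⟩ := exists_finsupp_of_mem_charSpan (eval_mem_charSpan hs (MvPolynomial.X c))
    -- for each character in the support, a polynomial computing `χ ∘ φ`
    have hq : ∀ χ : ↥(characterLattice T), ∃ q : MvPolynomial (GLCoord n) k, ∀ t₀ : ↥T₀,
        ((((χ : ↥T →* kˣ).comp φ) t₀ : kˣ) : k) = MvPolynomial.eval (glCoordFun (t₀ : GL n k)) q :=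
      fun χ => hφ χ χ.2
    choose q hq using hq
    refine ⟨cf.sum fun χ a => MvPolynomial.C a * q χ, fun t₀ => ?_⟩
    have h1 := hcf (φ t₀)
    simp only [MvPolynomial.eval_X] at h1
    rw [h1, Finsupp.sum, Finsupp.sum, map_sum]
    refine Finset.sum_congr rfl fun χ _ => ?_
    rw [map_mul, MvPolynomial.eval_C, ← hq χ t₀]
    rfl
  choose P hP using H
  exact ⟨P, fun t₀ c => hP c t₀⟩

/-- The same for a torus `T` (`IsTorusSubgroup`: connected, commutative, semisimple elements).
[cite: SpringerLAG1998, 3.2.3 (b) and 9.6.2 (proof)] -/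
theorem IsTorusSubgroup.isAlgebraicGL_of_isAlgebraicChar_comp [IsAlgClosed k]
    (hT : IsTorusSubgroup T) (φ : ↥T₀ →* ↥T)
    (hφ : ∀ χ : ↥T →* kˣ, IsAlgebraicChar χ → IsAlgebraicChar (χ.comp φ)) :
    MonoidHom.IsAlgebraicGL (T.subtype.comp φ) := by
  haveI : IsMulCommutative ↥T := hT.2.1
  exact Literature.NumberTheory.Automorphic.isAlgebraicGL_of_isAlgebraicChar_comp hT.2.2 φ hφ

end Literature.NumberTheory.Automorphic
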